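import Summits.RiemannHypothesis.RiemannHypothesis.Theorems.WeilFormatCPolyWindowMixedPieces
import HarnessLib

/-!
# Format C, design C∞ — (E) side III-b: the kernel box of the mixed entry `W_a(1x^j, χ_m)` (block × profile)

Route context: Fourier–Galerkin / Schur-complement certificates of Weil positivity on a window ("format C", design C∞;
`run/shared/lean/pub/rh-explicit/rh-explicit-weil-10/KERNEL-LEVER.md` §17 item (ii); supporting stmt-RiemannHypothesis-0098;
seats rh-explicit-weil-2 / weil-10).  Assembles the pieces of `WeilFormatCPolyWindowMixedPieces.lean` along the printed structure
of `WeilFormatCPolyWindowMixedEntry.weilWindowSesq_indicator_pow_chi` (`a > 0` rational, `m ≠ 0`): pole part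
`2C_j(−1)^m 2(e^{a/2}−e^{−a/2})/(√(2a)(1+4ω²)) + i·2S_j(−(−1)^m 4ω(e^{a/2}−e^{−a/2}))/(√(2a)(1+4ω²))`, prime part (light-table phases
`e^{iωℓ_q}`, weights `Λ(q)q^{−1/2}`), archimedean part (`J_c ∓ iJ_s`, `∫ρP_q` through the W-table, `ĉ_m(x^j)`, the tail) and the
Markov term — **`mixedBox`** with **`mem_mixedBox`**: `W_a(1x^j, χ_m) ∈ mixedBox …` given validated inputs (`ConstsValid`, `OffValid`,
`DiagValid`, boxes of `e^{±a/2}`, `1/√(2a)`, `ψ(¼)`, the W-table, the tail and `M_a`).  Interval plumbing; standard axioms; no RH claim.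
-/

set_option autoImplicit false
-- `Summit.RiemannHypothesis.RiemannHypothesis.…` is the layout-mandated namespace (summit = problem name).
set_option linter.dupNamespace false

open Complex Filter Set MeasureTheory Finset
open scoped Real Topology ArithmeticFunction.vonMangoldt ComplexConjugate

namespace Summit.RiemannHypothesis.RiemannHypothesis.Theorems.WeilFormatC

open Literature.NumberTheory.LFunctions Literature.Analysis.SpecialFunctions
open Literature.Analysis.ValidatedNumerics Literature.Analysis.ValidatedNumerics.NumericsMP
open Literature.NumberTheory.LFunctions.Yoshida1992 (PrimeLen PrimeData freq archExpSumSin)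
open Literature.NumberTheory.LFunctions.Yoshida1992.Encl (Consts ConstsValid IdxRec OffValid DiagValid sgn neg_one_zpow_eq_sgn
  list_sum_map_eq_sum_range)

namespace WinMixed

open WinConst (ratBox mem_ratBox mulRatBox mem_mulRatBox)
open WinPrime (powBox mem_powBox)
open WinPole (coshMomBox sinhMomBox mem_coshMomBox mem_sinhMomBox)
open WinEntry (sumBox mem_sumBox wtab)

/-! ## Small complex helpers -/

/-- `(x:ℂ) + (y:ℂ)·i ∈ ⟨X, Y⟩`. -/
theorem mem_ofReal_add_mul_I {S : ℕ} {x y : ℝ} {X Y : MI} (hx : MI.mem S x X) (hy : MI.mem S y Y) :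
    MC.mem S (((x : ℝ) : ℂ) + ((y : ℝ) : ℂ) * I) (MC.mk' X Y) := by
  have e : (((x : ℝ) : ℂ) + ((y : ℝ) : ℂ) * I) = (⟨x, y⟩ : ℂ) := by
    apply Complex.ext <;> simp
  rw [e]; exact MC.mem_mk' hx hy

/-- `(x:ℂ) − i·(y:ℂ) ∈ ⟨X, −Y⟩`. -/
theorem mem_ofReal_sub_I_mul {S : ℕ} {x y : ℝ} {X Y : MI} (hx : MI.mem S x X) (hy : MI.mem S y Y) :
    MC.mem S (((x : ℝ) : ℂ) - I * ((y : ℝ) : ℂ)) (MC.mk' X Y.neg) := by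
  have e : (((x : ℝ) : ℂ) - I * ((y : ℝ) : ℂ)) = (⟨x, -y⟩ : ℂ) := by
    apply Complex.ext <;> simp
  rw [e]; exact MC.mem_mk' hx (MI.mem_neg hy)

/-- `(x:ℂ) + i·(y:ℂ) ∈ ⟨X, Y⟩`. -/
theorem mem_ofReal_add_I_mul {S : ℕ} {x y : ℝ} {X Y : MI} (hx : MI.mem S x X) (hy : MI.mem S y Y) :
    MC.mem S (((x : ℝ) : ℂ) + I * ((y : ℝ) : ℂ)) (MC.mk' X Y) := by
  have e : (((x : ℝ) : ℂ) + I * ((y : ℝ) : ℂ)) = (⟨x, y⟩ : ℂ) := by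
    apply Complex.ext <;> simp
  rw [e]; exact MC.mem_mk' hx hy

/-- The sign `(−1)^m` as an integer. -/
def sgnZ (m : ℤ) : ℤ := if m % 2 = 0 then 1 else -1

/-- `(−1)^m = sgnZ m` in `ℝ`. -/
theorem neg_one_zpow_real (m : ℤ) : (-1 : ℝ) ^ m = (sgnZ m : ℝ) := by
  have h := neg_one_zpow_eq_sgn m 0
  rw [add_zero] at h
  rw [h, sgn, sgnZ, add_zero]

/-- `(−1)^m = sgnZ m` in `ℂ`. -/
theorem neg_one_zpow_complex (m : ℤ) : (-1 : ℂ) ^ m = (sgnZ m : ℂ) := by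
  have h := neg_one_zpow_real m
  have e : ((-1 : ℝ) : ℂ) ^ m = ((sgnZ m : ℝ) : ℂ) := by rw [← Complex.ofReal_zpow, h]
  push_cast at e
  exact e

/-! ## The inputs -/

/-- The validated inputs of one mixed-entry evaluation at the mode `m` of the window `a` (all boxes at scale `S`). -/
structure Inputs where
  /-- `e^{a/2}` -/
  Ep : MI
  /-- `e^{−a/2}` -/
  Em : MI
  /-- `1/√(2a)` -/
  Rs : MI
  /-- `ψ(¼)` -/
  Psi4 : MI
  /-- `1/ω_m` -/
  U : MI
  /-- `J_c(m)` -/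
  Jc : MI
  /-- table of window constants, entry `q−1 ∋ W_q(a)` -/
  tab : List MI
  /-- `∫_{(2a,∞)} ρ` -/
  T : MI
  /-- `M_a` -/
  Mk : MI
  deriving Repr, Inhabited

/-! ## The boxes -/

section Boxes

variable (S : ℕ) (a : ℚ) (m : ℤ) (j : ℕ) (C : Consts) (R : IdxRec) (X : Inputs)

/-- `((−iω)^{k+1})⁻¹ · (−1)^k j^{(k)}` -/
def coefBox (k : ℕ) : MC := (ipowBox S X.U (k + 1)).mulInt ((-1) ^ k * (j.descFactorial k : ℤ))

/-- Real part of the pole term. -/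
def poleReBox : MI :=
  ((coshMomBox X.Ep X.Em a j).mul S (((((X.Ep.sub X.Em).mulInt 2).mulInt (sgnZ m)).mul S X.Rs).mul S R.c)).mulInt 2

/-- Imaginary part of the pole term. -/
def poleImBox : MI :=
  ((sinhMomBox X.Ep X.Em a j).mul S
    ((((((X.Ep.sub X.Em).mul S R.om).mulInt 4).mulInt (sgnZ m)).neg.mul S X.Rs).mul S R.c)).mulInt 2

/-- The prime bracket at the prime power `i` (length box `L`, phase box `cs`), degree `j − k`. -/
def primeBracket (L : MI) (cs : MC) (k : ℕ) : MC :=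
  (((MC.ofMI S (ratBox S (a ^ (j - k)))).mul S ((MC.ofInt S 1).sub cs)).sub
      ((MC.ofMI S (ratBox S ((-a) ^ (j - k)))).mul S ((MC.ofInt S 1).sub cs.conj))).add
    (MC.ofMI S (((ratBox S (a ^ (j - k))).sub (powBox S ((ratBox S a).sub L) (j - k))).add
      ((powBox S (L.sub (ratBox S a)) (j - k)).sub (ratBox S ((-a) ^ (j - k))))))

/-- The inner prime sum at the prime power `i`: `r·(−1)^m·Σ_k coef_k·bracket_k`. -/
def primeInner (i : ℕ) : MC :=
  ((sumBoxC S (fun k ↦ (coefBox S j X k).mul S (primeBracket S a j (C.lens.getD i default) (R.cs.getD i default) k))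
    (j + 1)).mulMI S X.Rs).mulInt (sgnZ m)

/-- The prime part `Σ_i Λ_i · inner_i`. -/
def primeMixedBox (n : ℕ) : MC :=
  sumBoxC S (fun i ↦ (primeInner S a m j C R X i).mulMI S (C.wts.getD i default)) n

/-- The archimedean bracket, degree `j − k`: `a^{j−k}(J_c − iJ_s) − (−a)^{j−k}(J_c + iJ_s) + ∫ρP_{j−k}`. -/
def archBracket (k : ℕ) : MC :=
  (((MC.ofMI S (ratBox S (a ^ (j - k)))).mul S (MC.mk' X.Jc (jsBox R).neg)).sub
      ((MC.ofMI S (ratBox S ((-a) ^ (j - k)))).mul S (MC.mk' X.Jc (jsBox R)))).add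
    (MC.ofMI S (polyIntBox S X.tab a (j - k)))

/-- The first archimedean part `r·(−1)^m·Σ_k coef_k·archBracket_k`. -/
def archMixedBox : MC :=
  ((sumBoxC S (fun k ↦ (coefBox S j X k).mul S (archBracket S a j R X k)) (j + 1)).mulMI S X.Rs).mulInt (sgnZ m)

/-- `r · ĉ_m(x^j)`. -/
def rFourierBox : MC := (fourierBox S X.U (sgnZ m) a j).mulMI S X.Rs

/-- **The mixed-entry box.** -/
def mixedBox : MC :=
  ((MC.mk' (poleReBox S a m j R X) (poleImBox S a m j R X)).add
      ((primeMixedBox S a m j C R X C.lens.length).add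
        ((archMixedBox S a m j R X).add (((rFourierBox S a m j X).mulMI S X.T).mulInt 2)))).sub
    ((rFourierBox S a m j X).mulMI S X.Mk)

end Boxes

/-! ## Soundness -/

section Sound

variable {S : ℕ} {a : ℚ} {m : ℤ} {j : ℕ} {ks : List PrimeLen} {C : Consts} {R : IdxRec} {X : Inputs} {Q : ℕ}

/-- Validity of the inputs. -/
structure InputsValid (S : ℕ) (a : ℚ) (m : ℤ) (Q : ℕ) (X : Inputs) : Prop where
  /-- `e^{a/2} ∈ Ep` -/
  Ep : MI.mem S (Real.exp ((a : ℝ) / 2)) X.Ep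
  /-- `e^{−a/2} ∈ Em` -/
  Em : MI.mem S (Real.exp (-((a : ℝ) / 2))) X.Em
  /-- `1/√(2a) ∈ Rs` -/
  Rs : MI.mem S (1 / Real.sqrt (2 * (a : ℝ))) X.Rs
  /-- `ψ(¼) ∈ Psi4` -/
  Psi4 : MI.mem S (reDigammaQuarter 0) X.Psi4
  /-- `1/ω_m ∈ U` -/
  U : MI.mem S (π * m / (a : ℝ))⁻¹ X.U
  /-- `J_c(m) ∈ Jc` -/
  Jc : MI.mem S (∫ t in Ioc 0 (2 * (a : ℝ)), weilArchDensity t * (1 - Real.cos (π * m / (a : ℝ) * t))) X.Jc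
  /-- the table of window constants up to `Q` -/
  tab : ∀ q, 1 ≤ q → q ≤ Q → MI.mem S (∫ t in Ioc 0 (2 * (a : ℝ)), weilArchDensity t * t ^ q) (wtab X.tab q)
  /-- the tail -/
  T : MI.mem S (∫ t in Ioi (2 * (a : ℝ)), weilArchDensity t) X.T
  /-- the Markov constant -/
  Mk : MI.mem S (weilMarkovConstant (a : ℝ)) X.Mk

/-- `coefBox ∋ (−1)^k j^{(k)} / (−iω)^{k+1}`. -/
theorem mem_coefBox (hS : 0 < S) (hX : InputsValid S a m Q X) (k : ℕ) :
    MC.mem S ((-1 : ℂ) ^ k * (j.descFactorial k : ℂ) / (-(I * ((π * m / (a : ℝ) : ℝ) : ℂ))) ^ (k + 1))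
      (coefBox S j X k) := by
  rw [div_eq_mul_inv, inv_neg_I_mul_pow, coefBox]
  have h := MC.mem_mulInt (mem_ipowBox hS hX.U (k + 1)) ((-1) ^ k * (j.descFactorial k : ℤ))
  convert h using 1
  push_cast
  ring

/-- The pole part. -/
theorem mem_pole (hS : 0 < S) (ha : 0 < a) (hR : OffValid S (a : ℝ) ks m R) (hX : InputsValid S a m Q X) :
    MC.mem S (((2 * (∫ x in (-(a : ℝ))..(a : ℝ), x ^ j * Real.cosh (x / 2)) *
            ((-1 : ℝ) ^ m * (2 * (Real.exp ((a : ℝ) / 2) - Real.exp (-((a : ℝ) / 2)))) /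
              (Real.sqrt (2 * (a : ℝ)) * (1 + 4 * (π * m / (a : ℝ)) ^ 2))) : ℝ) : ℂ) +
          ((2 * (∫ x in (-(a : ℝ))..(a : ℝ), x ^ j * Real.sinh (x / 2)) *
            (-((-1 : ℝ) ^ m * (4 * (π * m / (a : ℝ)) * (Real.exp ((a : ℝ) / 2) - Real.exp (-((a : ℝ) / 2))))) /
              (Real.sqrt (2 * (a : ℝ)) * (1 + 4 * (π * m / (a : ℝ)) ^ 2))) : ℝ) : ℂ) * I)
      (MC.mk' (poleReBox S a m j R X) (poleImBox S a m j R X)) := by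
  have hc := hR.c
  have hω := hR.om
  simp only [freq] at hc hω
  have hs := MI.mem_sub hX.Ep hX.Em
  have ha' : (0 : ℝ) < a := by exact_mod_cast ha
  have hsq : Real.sqrt (2 * (a : ℝ)) ≠ 0 := (Real.sqrt_pos.2 (by positivity)).ne'
  have hd : (1 + 4 * (π * m / (a : ℝ)) ^ 2) ≠ 0 := by positivity
  refine mem_ofReal_add_mul_I ?_ ?_
  · have h := MI.mem_mulInt (MI.mem_mul hS (mem_coshMomBox hX.Ep hX.Em j)
      (MI.mem_mul hS (MI.mem_mul hS (MI.mem_mulInt (MI.mem_mulInt hs 2) (sgnZ m)) hX.Rs) hc)) 2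
    rw [poleReBox]
    convert h using 1
    rw [neg_one_zpow_real]
    push_cast
    field_simp
  · have h := MI.mem_mulInt (MI.mem_mul hS (mem_sinhMomBox hX.Ep hX.Em j)
      (MI.mem_mul hS (MI.mem_mul hS (MI.mem_neg (MI.mem_mulInt (MI.mem_mulInt (MI.mem_mul hS hs hω) 4) (sgnZ m)))
        hX.Rs) hc)) 2
    rw [poleImBox]
    convert h using 1
    rw [neg_one_zpow_real]
    push_cast
    field_simp

/-- The prime bracket at a prime power with length `ℓ` and phase `e^{iωℓ}`. -/
theorem mem_primeBracket (hS : 0 < S) {ℓ : ℝ} {L : MI} (hL : MI.mem S ℓ L) {cs : MC}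
    (hcs : MC.mem S (Complex.exp (((((π * m / (a : ℝ)) * ℓ : ℝ)) : ℂ) * I)) cs) (k : ℕ) :
    MC.mem S (((a : ℝ) : ℂ) ^ (j - k) * (1 - cexp (I * ((π * m / (a : ℝ) : ℝ) : ℂ) * (ℓ : ℂ)))
        - ((-(a : ℝ) : ℝ) : ℂ) ^ (j - k) * (1 - cexp (-(I * ((π * m / (a : ℝ) : ℝ) : ℂ) * (ℓ : ℂ))))
        + (((a : ℝ) : ℂ) ^ (j - k) - (((a : ℝ) - ℓ : ℝ) : ℂ) ^ (j - k))
        + (((-(a : ℝ) + ℓ : ℝ) : ℂ) ^ (j - k) - ((-(a : ℝ) : ℝ) : ℂ) ^ (j - k)))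
      (primeBracket S a j L cs k) := by
  have e1 : cexp (I * ((π * m / (a : ℝ) : ℝ) : ℂ) * (ℓ : ℂ)) = Complex.exp (((((π * m / (a : ℝ)) * ℓ : ℝ)) : ℂ) * I) := by
    congr 1; push_cast; ring
  have e2 : cexp (-(I * ((π * m / (a : ℝ) : ℝ) : ℂ) * (ℓ : ℂ))) =
      conj (Complex.exp (((((π * m / (a : ℝ)) * ℓ : ℝ)) : ℂ) * I)) := by
    rw [← Complex.exp_conj]; congr 1
    rw [map_mul, Complex.conj_ofReal, Complex.conj_I]; push_cast; ring
  rw [e1, e2, primeBracket, add_assoc]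
  have hA := MC.mem_ofMI (S := S) (mem_ratBox S (a ^ (j - k)))
  have hB := MC.mem_ofMI (S := S) (mem_ratBox S ((-a) ^ (j - k)))
  have h1 := MC.mem_sub (MC.mem_mul hS hA (MC.mem_sub (MC.mem_ofInt S 1) hcs))
    (MC.mem_mul hS hB (MC.mem_sub (MC.mem_ofInt S 1) (MC.mem_conj hcs)))
  have hreal : MI.mem S ((((a : ℝ)) ^ (j - k) - ((a : ℝ) - ℓ) ^ (j - k)) + ((-(a : ℝ) + ℓ) ^ (j - k) - (-(a : ℝ)) ^ (j - k)))
      (((ratBox S (a ^ (j - k))).sub (powBox S ((ratBox S a).sub L) (j - k))).add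
        ((powBox S (L.sub (ratBox S a)) (j - k)).sub (ratBox S ((-a) ^ (j - k))))) := by
    have h3 := MI.mem_sub (mem_ratBox S (a ^ (j - k))) (mem_powBox hS (MI.mem_sub (mem_ratBox S a) hL) (j - k))
    have h4 := MI.mem_sub (mem_powBox hS (MI.mem_sub hL (mem_ratBox S a)) (j - k)) (mem_ratBox S ((-a) ^ (j - k)))
    have h := MI.mem_add h3 h4
    convert h using 1
    push_cast
    ring
  have h := MC.mem_add h1 (MC.mem_ofMI hreal)
  convert h using 2
  · push_cast; ring
  · push_cast; ring

/-- The prime part. -/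
theorem mem_prime (hS : 0 < S) (hks : PrimeData (a : ℝ) ks) (hC : ConstsValid S (a : ℝ) ks C)
    (hR : OffValid S (a : ℝ) ks m R) (hX : InputsValid S a m Q X) :
    MC.mem S (∑ n ∈ weilPrimeIndex (a : ℝ), ((Λ n : ℝ) / Real.sqrt n : ℂ) *
        (((1 / Real.sqrt (2 * (a : ℝ)) : ℝ) : ℂ) * (-1 : ℂ) ^ m *
          ∑ k ∈ Finset.range (j + 1), (-1 : ℂ) ^ k * (j.descFactorial k : ℂ) / (-(I * ((π * m / (a : ℝ) : ℝ) : ℂ))) ^ (k + 1) *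
            (((a : ℝ) : ℂ) ^ (j - k) * (1 - cexp (I * ((π * m / (a : ℝ) : ℝ) : ℂ) * (Real.log n : ℝ)))
              - ((-(a : ℝ) : ℝ) : ℂ) ^ (j - k) * (1 - cexp (-(I * ((π * m / (a : ℝ) : ℝ) : ℂ) * (Real.log n : ℝ))))
              + (((a : ℝ) : ℂ) ^ (j - k) - (((a : ℝ) - Real.log n : ℝ) : ℂ) ^ (j - k))
              + (((-(a : ℝ) + Real.log n : ℝ) : ℂ) ^ (j - k) - ((-(a : ℝ) : ℝ) : ℂ) ^ (j - k)))))
      (primeMixedBox S a m j C R X ks.length) := by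
  have hbr := sum_weilPrimeIndex_mul_eq_listSum_complex hks (fun ℓ : ℝ ↦
    (((1 / Real.sqrt (2 * (a : ℝ)) : ℝ) : ℂ) * (-1 : ℂ) ^ m *
      ∑ k ∈ Finset.range (j + 1), (-1 : ℂ) ^ k * (j.descFactorial k : ℂ) / (-(I * ((π * m / (a : ℝ) : ℝ) : ℂ))) ^ (k + 1) *
        (((a : ℝ) : ℂ) ^ (j - k) * (1 - cexp (I * ((π * m / (a : ℝ) : ℝ) : ℂ) * (ℓ : ℝ)))
          - ((-(a : ℝ) : ℝ) : ℂ) ^ (j - k) * (1 - cexp (-(I * ((π * m / (a : ℝ) : ℝ) : ℂ) * (ℓ : ℝ))))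
          + (((a : ℝ) : ℂ) ^ (j - k) - (((a : ℝ) - ℓ : ℝ) : ℂ) ^ (j - k))
          + (((-(a : ℝ) + ℓ : ℝ) : ℂ) ^ (j - k) - ((-(a : ℝ) : ℝ) : ℂ) ^ (j - k)))))
  beta_reduce at hbr
  simp_rw [← Complex.ofReal_div]
  rw [hbr, list_sum_map_eq_sum_range_complex, primeMixedBox]
  refine mem_sumBoxC ks.length fun i hi ↦ ?_
  have hinner : MC.mem S (((1 / Real.sqrt (2 * (a : ℝ)) : ℝ) : ℂ) * (-1 : ℂ) ^ m *
      ∑ k ∈ Finset.range (j + 1), (-1 : ℂ) ^ k * (j.descFactorial k : ℂ) / (-(I * ((π * m / (a : ℝ) : ℝ) : ℂ))) ^ (k + 1) *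
        (((a : ℝ) : ℂ) ^ (j - k) * (1 - cexp (I * ((π * m / (a : ℝ) : ℝ) : ℂ) * ((ks.getD i default).len : ℂ)))
          - ((-(a : ℝ) : ℝ) : ℂ) ^ (j - k) * (1 - cexp (-(I * ((π * m / (a : ℝ) : ℝ) : ℂ) * ((ks.getD i default).len : ℂ))))
          + (((a : ℝ) : ℂ) ^ (j - k) - (((a : ℝ) - (ks.getD i default).len : ℝ) : ℂ) ^ (j - k))
          + (((-(a : ℝ) + (ks.getD i default).len : ℝ) : ℂ) ^ (j - k) - ((-(a : ℝ) : ℝ) : ℂ) ^ (j - k))))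
      (primeInner S a m j C R X i) := by
    rw [primeInner, neg_one_zpow_complex]
    have hsum := mem_sumBoxC (S := S) (j + 1) fun k _ ↦
      MC.mem_mul hS (mem_coefBox (j := j) hS hX k) (mem_primeBracket (j := j) hS (hC.lens i hi) (by
        have := hR.cs i hi; simp only [freq] at this; exact this) k)
    have h := MC.mem_mulInt (MC.mem_mulMI hS hsum hX.Rs) (sgnZ m)
    convert h using 1
    push_cast
    ring
  have h := MC.mem_mulMI hS hinner (hC.wts i hi)
  convert h using 1
  ring

/-- The archimedean bracket. -/
theorem mem_archBracket (hS : 0 < S) (ha : 0 < a) (hR : OffValid S (a : ℝ) ks m R) (hX : InputsValid S a m Q X)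
    {k : ℕ} (hk : j - k ≤ Q) :
    MC.mem S (((a : ℝ) : ℂ) ^ (j - k) *
          (∫ t in Ioc 0 (2 * (a : ℝ)), (weilArchDensity t : ℂ) * (1 - cexp (I * ((π * m / (a : ℝ) : ℝ) : ℂ) * (t : ℂ))))
        - ((-(a : ℝ) : ℝ) : ℂ) ^ (j - k) *
          (∫ t in Ioc 0 (2 * (a : ℝ)), (weilArchDensity t : ℂ) * (1 - cexp (-(I * ((π * m / (a : ℝ) : ℝ) : ℂ) * (t : ℂ)))))
        + ((∫ t in Ioc 0 (2 * (a : ℝ)), weilArchDensity t *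
            (((a : ℝ) ^ (j - k) - ((a : ℝ) - t) ^ (j - k)) + ((-(a : ℝ) + t) ^ (j - k) - (-(a : ℝ)) ^ (j - k))) : ℝ) : ℂ))
      (archBracket S a j R X k) := by
  have ha' : (0 : ℝ) < a := by exact_mod_cast ha
  rw [setIntegral_weilArchDensity_mul_one_sub_cexp ha', setIntegral_weilArchDensity_mul_one_sub_cexp_neg ha', archBracket]
  have hJs := mem_jsBox ha hR
  have hminus := mem_ofReal_sub_I_mul hX.Jc hJs
  have hplus := mem_ofReal_add_I_mul hX.Jc hJs
  have hA := MC.mem_ofMI (S := S) (mem_ratBox S (a ^ (j - k)))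
  have hB := MC.mem_ofMI (S := S) (mem_ratBox S ((-a) ^ (j - k)))
  have hP := MC.mem_ofMI (mem_polyIntBox (S := S) ha hX.tab hk)
  have h := MC.mem_add (MC.mem_sub (MC.mem_mul hS hA hminus) (MC.mem_mul hS hB hplus)) hP
  convert h using 2
  all_goals (push_cast; ring)

/-- The first archimedean part. -/
theorem mem_arch (hS : 0 < S) (ha : 0 < a) (hR : OffValid S (a : ℝ) ks m R) (hX : InputsValid S a m Q X)
    (hjQ : j ≤ Q) :
    MC.mem S (((1 / Real.sqrt (2 * (a : ℝ)) : ℝ) : ℂ) * (-1 : ℂ) ^ m *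
        ∑ k ∈ Finset.range (j + 1), (-1 : ℂ) ^ k * (j.descFactorial k : ℂ) / (-(I * ((π * m / (a : ℝ) : ℝ) : ℂ))) ^ (k + 1) *
          (((a : ℝ) : ℂ) ^ (j - k) *
              (∫ t in Ioc 0 (2 * (a : ℝ)), (weilArchDensity t : ℂ) * (1 - cexp (I * ((π * m / (a : ℝ) : ℝ) : ℂ) * (t : ℂ))))
            - ((-(a : ℝ) : ℝ) : ℂ) ^ (j - k) *
              (∫ t in Ioc 0 (2 * (a : ℝ)), (weilArchDensity t : ℂ) * (1 - cexp (-(I * ((π * m / (a : ℝ) : ℝ) : ℂ) * (t : ℂ)))))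
            + ((∫ t in Ioc 0 (2 * (a : ℝ)), weilArchDensity t *
                (((a : ℝ) ^ (j - k) - ((a : ℝ) - t) ^ (j - k)) + ((-(a : ℝ) + t) ^ (j - k) - (-(a : ℝ)) ^ (j - k))) : ℝ) : ℂ)))
      (archMixedBox S a m j R X) := by
  rw [archMixedBox, neg_one_zpow_complex]
  have hsum := mem_sumBoxC (S := S) (j + 1) fun k _ ↦
    MC.mem_mul hS (mem_coefBox (j := j) hS hX k) (mem_archBracket (j := j) (k := k) hS ha hR hX (le_trans (Nat.sub_le j k) hjQ))
  have h := MC.mem_mulInt (MC.mem_mulMI hS hsum hX.Rs) (sgnZ m)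
  convert h using 1
  push_cast
  ring

/-- `rFourierBox ∋ (1/√(2a))·ĉ_m(x^j)`. -/
theorem mem_rFourier (hS : 0 < S) (ha : 0 < a) (hm : m ≠ 0) (hX : InputsValid S a m Q X) :
    MC.mem S (((1 / Real.sqrt (2 * (a : ℝ)) : ℝ) : ℂ) * Yoshida1992.fourierCoeff (a : ℝ) m (fun x : ℝ ↦ ((x : ℂ)) ^ j))
      (rFourierBox S a m j X) := by
  rw [rFourierBox, mul_comm]
  exact MC.mem_mulMI hS (mem_fourierBox hS ha hm hX.U (neg_one_zpow_complex m) j) hX.Rs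

/-- **Soundness of the mixed-entry box**: for a rational window `a > 0`, a mode `m ≠ 0` with a valid light-table record `R`
(off-diagonal fields), prime data `ks` with validated constants `C`, and valid inputs `X` (table up to `Q ≥ j`):
`W_a(1x^j, χ_m) ∈ mixedBox S a m j C R X`. -/
theorem mem_mixedBox (hS : 0 < S) (ha : 0 < a) (hm : m ≠ 0) (hks : PrimeData (a : ℝ) ks)
    (hC : ConstsValid S (a : ℝ) ks C) (hR : OffValid S (a : ℝ) ks m R) (hX : InputsValid S a m Q X) (hjQ : j ≤ Q) :
    MC.mem S (weilWindowSesq (a : ℝ) ((Icc (-(a : ℝ)) (a : ℝ)).indicator fun x : ℝ ↦ ((x : ℂ)) ^ j) (Yoshida1992.chi (a : ℝ) m))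
      (mixedBox S a m j C R X) := by
  have ha' : (0 : ℝ) < a := by exact_mod_cast ha
  rw [weilWindowSesq_indicator_pow_chi ha' hm j, mixedBox, hC.lens_len]
  have hF := mem_rFourier (j := j) hS ha hm hX
  exact MC.mem_sub
    (MC.mem_add (mem_pole hS ha hR hX)
      (MC.mem_add (mem_prime (j := j) hS hks hC hR hX)
        (MC.mem_add (mem_arch hS ha hR hX hjQ) (by
          have h := MC.mem_mulInt (MC.mem_mulMI hS hF hX.T) 2
          convert h using 1
          ring))))
    (by
      have h := MC.mem_mulMI hS hF hX.Mk
      convert h using 1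
      ring)

end Sound

end WinMixed

end Summit.RiemannHypothesis.RiemannHypothesis.Theorems.WeilFormatC
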